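import Summits.BirchSwinnertonDyer.BirchSwinnertonDyer.Theorems.InertBadSignedBranchesCccOneLawOnTypeIstarZeroCollinearMuPrediction
import Literature.NumberTheory.EllipticCurves.KatoFineSelmerDualUniquenessProofs
import HarnessLib

set_option linter.dupNamespace false
set_option autoImplicit false

/-!
# `CccOneLawOnTypeIstarZero` (stmt-BirchSwinnertonDyer-19223), line `kato_perrin_riou_istar` v11 —
# PACKAGE RIGIDITY of the research stub 2c `stub_muColPlusAdmissibleIstarZero`

Refill hand `leafhand-bsd-inertbadsignedbran-5` g0 (prover), 2026-08-31; DEF-FREE helper `--supports 19223 --as helper`.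
Skeleton of record `Cruxes/CccOneLawOnTypeIstarZero/Lines/kato_perrin_riou_istar.lean` v11, sha `d5290a4395abfc6e`
(planner bsd-cm-plan g39, D1154).  Nothing here is registered, no stub is closed, nothing is asserted unconditionally
about the open items 19865 / 19867 / 19223; BSD is proved for no curve.

## What this file proves (kernel)

The registered research stub 2c reads, for every `η`-frame of the Kobayashi package fact, every pin
`I : 𝐇¹_Γ(T_pW)`, every dual fine Selmer datum `FB`, every Kobayashi package
`P : Kobayashi2003.EtaColemanPoitouTateData … W I FB` and every ADMISSIBLE Kato class `z₀ ∈ 𝐇¹_Γ(T_pW)`: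
`length_(p) (Λ ⧸ (P.colPlus z₀)) = length_(p) (Λ ⧸ (P.colPlus P.z))` («`μ(Col⁺(loc z₀)) = μ(L_p⁺(V, η, X))`»).
The package `P` is an EXISTENTIAL hypothesis structure (its class `P.z` and its functional `P.colPlus` are fields, not
tree constructions), so a priori the stub could depend on WHICH package is taken.  It does not:

* §1 `muInvariant_quotient_kobayashiClass_eq_of_packages` — granted the route's named-fact item 19867
  `PublishedInputsEtaUpToP` (Burungale–Tian Thm. 2.6 at `η` ∧ Kobayashi Thm. 2.2 at `η`), ANY two packages `P` (on
  `(I, FB)`) and `P′` (on `(I, FB′)`) have `μ(𝐇¹_Γ ⧸ Λ∙P.z) = μ(𝐇¹_Γ ⧸ Λ∙P′.z)`: both equal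
  `μ(Λ/(L_p⁺)) + μ(X₀(W/ℚ_∞)) − μ(X⁺(V/K_∞)^η)` by hand -3's `μ`-dictionary
  `CccOneMuDictionaryEta.muInvariant_add_eq_of_etaColemanPoitouTate`, the two pinned `X₀` data being `Λ`-isomorphic
  (`FineSelmerDualData.nonempty_linearEquiv`); `lengthAt_quotient_kobayashiClass_eq_of_packages` is the `length_(p)` form.
* §2 `stub2c_iff_of_packages` — hence, for every class `z₀ ≠ 0` (in particular every admissible one), the stub-2c
  equality for `P` holds IFF it holds for `P′` (through hand -4's Coleman-image form
  `CccOneCollinearMu.lengthAt_quotient_span_eq_iff_lengthAt_image`): the registered «∀ P» carries no more than «∃ P».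
* §3 `stub2c_forall_iff_exists` — together with the `Λˣ`-rigidity of the admissible side (hand -4's
  `CccOneCollinearMu.forall_admissible_lengthAt_eq_of_exists`, under the named fact ★
  `Kato2004.exists_zetaClassPosition_of_rank_le_one` and `rank_Λ 𝐇¹_Γ ≤ 1`): on a fixed pin `I` the stub-2c equality
  for ALL `(FB, P, z₀)` is equivalent to it for ONE `(FB, P, z₀)` — the research content of stub 2c is ONE natural number
  per pin (the integer `μ(Col⁺ z₀) − μ(Col⁺ P.z)`, hand -4's `m − n`).
* §5 `stub2c_of_isPlus_colPlus` (UNCONDITIONAL) / `exists_eq_C_units_smul_of_isPlus_colPlus` /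
  `stub2c_of_isPlus_colPlus_of_packages` — the typed residual in VALUE-LAW form: if the plus-Coleman image
  `P.colPlus z₀` of the admissible class has Kobayashi's plus interpolation property
  (`IsQuadraticBranchPlusLFunction f p ϖ (P.colPlus z₀)`: «`Col⁺(loc 𝐳_{γ_W}) = u·L_p⁺(V, η, X)`, `u ∈ ℤ_pˣ`»), then the
  stub-2c equality holds at `P` at every prime (plus functions are unique up to `ℤ_pˣ`), `z₀ = c • P.z` with a CONSTANT
  `c ∈ ℤ_pˣ`, and (granted 19867) stub 2c holds at every package.  This is the shape a typed value law would have.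
* §4 `stub2c_of_exists_units_smul` — the sufficient unit form «ZC»: if `z₀ = u • P.z` for some `u ∈ Λˣ` and ONE
  package `P`, then the stub-2c equality holds for EVERY package `P′` on the pin.  «ZC» is the twist-compatibility of
  Kato's zeta elements under `W = V ⊗ η` up to a `p`-adic unit (Kato Thm. 12.5 (1) for `f_V` at the characters `ηχ`
  and for `f_W` at `χ`, read through the `ℚ(√p*)`-isomorphism `V ≅ W`); it is NOT asserted here (census of this hand).

Honest label: bookkeeping only; closes no stub; 19223 stays OPEN.
-/

noncomputable section

open scoped Classical

open CongruenceSubgroup WeierstrassCurve Field Literature.NumberTheory.EllipticCurves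
  Literature.NumberTheory.EllipticCurves.ModularForms Literature.NumberTheory.EllipticCurves.IwasawaAlgebra
  Literature.NumberTheory.EllipticCurves.Kato2004 ZpExtension Module
  Summit.BirchSwinnertonDyer.BirchSwinnertonDyer.Theses.InertBadSignedBranches
  Summit.BirchSwinnertonDyer.Rank1Residual

namespace Summit.BirchSwinnertonDyer.BirchSwinnertonDyer.Theorems.CccOnePackageRigidity

variable {p : ℕ} [Fact p.Prime]

section Frame

variable (hp : p ≠ 2) (K₀ : Type) [Field K₀] [NumberField K₀]
  [IsCyclotomicExtension {p} ℚ K₀] [(galRange (K := ℚ) K₀).Normal]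
  (η : absoluteGaloisGroup ℚ →* ℤˣ) (hη : ∀ σ ∈ galRange (K := ℚ) K₀, η σ = 1) (hη1 : η ≠ 1)
  (V : WeierstrassCurve ℚ) [V.IsElliptic] [V.IsGloballyMinimal] {N : ℕ} [NeZero N]
  {f : CuspForm (Gamma0 N) 2} (hCM : V.HasCM) (hgood : V.HasGoodReductionAtPrime p)
  (hap : V.frobeniusTrace p = 0) (hf : IsNewformOf V f) (ϖ : ℚ)
  (hϖ : if Even (p / 2) then (ϖ : ℝ) * V.realPeriodRat = plusPeriod f
    else (ϖ : ℝ) * V.imaginaryPeriodRat = minusPeriod f)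
  (κ : ZpExtension ℚ p) (γ : absoluteGaloisGroup ℚ) (hκ : κ.IsCyclotomic) (hγ : κ.IsTopGenerator γ)
  (hγK : γ ∈ galRange (K := ℚ) K₀) (hvar : IsCyclotomicVariable p γ)
  (W : WeierstrassCurve ℚ) [W.IsElliptic] [ContinuousSMul ℤ_[p] (W.tateModule p)]
  (I : Kato2004.IwasawaH1Data W p κ γ) {FB FB' : W.FineSelmerDualData κ γ}
  (P : Kobayashi2003.EtaColemanPoitouTateData p K₀ η V f ϖ κ γ W I FB)
  (P' : Kobayashi2003.EtaColemanPoitouTateData p K₀ η V f ϖ κ γ W I FB')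

include hp hη hη1 hCM hgood hap hf hϖ hκ hγ hγK hvar

/-! ## §1 The Kato-currency `μ` at Kobayashi's class does not depend on the package -/

/-- **Package-independence of `μ(𝐇¹_Γ(T_pW) ⧸ Λ∙P.z)` (kernel, granted 19867).** In the `η`-frame of items
19501/19865 (CM twin `V`, good supersingular at the odd prime `p`, newform `f`, period ratio `ϖ`, `K₀ = ℚ(μ_p)`, the
quadratic `η`, cyclotomic `(κ, γ)` on the cyclotomic variable), for a curve `W` with pin `I : 𝐇¹_Γ(T_pW)` and ANY two
Kobayashi packages `P` (over a dual fine Selmer datum `FB`) and `P′` (over `FB′`):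
`μ(𝐇¹_Γ ⧸ Λ∙P.z) = μ(𝐇¹_Γ ⧸ Λ∙P′.z)`.  Proof: hand -3's four-term `μ`-bookkeeping
`μ(X(D)) + μ(𝐇¹_Γ/Λ∙z) = μ(Λ/(Lp)) + μ(X₀)` for both packages with the SAME plus function `Lp := P.colPlus P.z` and the
SAME plus dual datum `D`, and `X₀(FB) ≃ X₀(FB′)` (`FineSelmerDualData.nonempty_linearEquiv`).
[cite: Kobayashi2003, Thm. 6.3 (p. 11), Thm. 7.3 i) (7.21) and proof of Thm. 7.4 (p. 13)]
[cite: BurungaleTian2026, Thm. 2.6 and Rem. 2.7 (p. 5)] [cite: Washington1997, §13.2] -/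
theorem muInvariant_quotient_kobayashiClass_eq_of_packages (hF : PublishedInputsEtaUpToP) :
    muInvariant p (I.H ⧸ Submodule.span (IwasawaAlgebra p) {P.z}) =
      muInvariant p (I.H ⧸ Submodule.span (IwasawaAlgebra p) {P'.z}) := by
  obtain ⟨h26, h22⟩ := hF
  obtain ⟨Dₐ⟩ := Additive.nonempty_etaSignedSelmerDualData_cyclotomic V κ K₀ ℚ_[p] η (1 : ℤˣ) hγ hγK
  let D : Kobayashi2003.EtaSignedSelmerDualData V κ K₀ ℚ_[p] η γ 1 :=
    ⟨Dₐ.X, Dₐ.conj_mem, Dₐ.toDual, Dₐ.bijective, Dₐ.toDual_T_smul, Dₐ.toDual_C_smul⟩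
  have hLp : Kobayashi2003.IsQuadraticBranchPlusLFunction f p ϖ (P.colPlus P.z) := P.isPlus_colPlus_z
  have e := CccOneMuDictionaryEta.muInvariant_add_eq_of_etaColemanPoitouTate hp K₀ η hη hη1 V hCM hgood hap hf ϖ
    hϖ κ γ hκ hγ hγK hvar W I FB P h26 h22 (P.colPlus P.z) hLp D
  have e' := CccOneMuDictionaryEta.muInvariant_add_eq_of_etaColemanPoitouTate hp K₀ η hη hη1 V hCM hgood hap hf ϖ
    hϖ κ γ hκ hγ hγK hvar W I FB' P' h26 h22 (P.colPlus P.z) hLp D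
  -- the two pinned `X₀(W/ℚ_∞)` data are `Λ`-isomorphic, so their `μ` agree
  have hX₀ : muInvariant p FB.X = muInvariant p FB'.X := by
    obtain ⟨eX⟩ := WeierstrassCurve.FineSelmerDualData.nonempty_linearEquiv FB FB'
    let 𝔭 : PrimeSpectrum (IwasawaAlgebra p) := ⟨augIdealP p, isPrime_augIdealP_holds p⟩
    rw [muInvariant_eq_toNat_lengthAt p _ 𝔭 rfl, muInvariant_eq_toNat_lengthAt p _ 𝔭 rfl,
      Module.lengthAt_eq_of_linearEquiv eX 𝔭]
  omega

omit [IsCyclotomicExtension {p} ℚ K₀] hη hη1 hCM hap hκ hγ hγK hvar in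
/-- **`P.colPlus P.z ≠ 0`** — a plus function `L_p⁺(V, η, X)` is non-zero (Rohrlich, tree theorem
`Additive.IsQuadraticBranchPlusLFunction.ne_zero_of_isNewformOf`; `ϖ ≠ 0` from the period relation and `Ω_V^± ≠ 0`).
[cite: Kobayashi2003, Thm. 3.2 (p. 7), Thm. 6.3 (p. 11)] [cite: RohrlichInventiones1984, Theorem (p. 409)] -/
theorem colPlus_z_ne_zero : P.colPlus P.z ≠ 0 := by
  have hϖ0 : ϖ ≠ 0 := by
    rintro rfl
    rw [Rat.cast_zero, zero_mul, zero_mul] at hϖ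
    by_cases he : Even (p / 2)
    · rw [if_pos he] at hϖ
      exact (IsNewform0.plusPeriod_pos_holds hf.1 hf.coeffField_eq_bot).ne hϖ
    · rw [if_neg he] at hϖ
      exact (IsNewform0.minusPeriod_pos_holds hf.1 hf.coeffField_eq_bot).ne hϖ
  have hLpA : Additive.IsQuadraticBranchPlusLFunction f p ϖ (P.colPlus P.z) := P.isPlus_colPlus_z
  exact Additive.IsQuadraticBranchPlusLFunction.ne_zero_of_isNewformOf hp hf hgood hϖ0 hLpA

/-- **The `length_(p)` form of §1**: for any two packages `P`, `P′` on the pin and `𝔮 = (p)`,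
`length_𝔮 (𝐇¹_Γ ⧸ Λ∙P.z) = length_𝔮 (𝐇¹_Γ ⧸ Λ∙P′.z)` (both quotients are finitely generated torsion — `Col⁺` injective
with `Col⁺ z ≠ 0` — so the `μ`-equality lifts). [cite: Kobayashi2003, Thm. 7.3 i) and proof of Thm. 7.4 (p. 13)]
[cite: Washington1997, §13.2] -/
theorem lengthAt_quotient_kobayashiClass_eq_of_packages (hF : PublishedInputsEtaUpToP)
    (𝔮 : PrimeSpectrum (IwasawaAlgebra p)) (h𝔮 : 𝔮.asIdeal = augIdealP p) :
    lengthAt (IwasawaAlgebra p) (I.H ⧸ Submodule.span (IwasawaAlgebra p) {P.z}) 𝔮 =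
      lengthAt (IwasawaAlgebra p) (I.H ⧸ Submodule.span (IwasawaAlgebra p) {P'.z}) 𝔮 := by
  have hμ := muInvariant_quotient_kobayashiClass_eq_of_packages hp K₀ η hη hη1 V hCM hgood hap hf ϖ hϖ κ γ hκ hγ
    hγK hvar W I P P' hF
  haveI : Module.Finite (IwasawaAlgebra p) I.H := Kato2004.IwasawaH1Data.module_finite_of_isCyclotomic hκ hγ I
  have hA : lengthAt (IwasawaAlgebra p) (I.H ⧸ Submodule.span (IwasawaAlgebra p) {P.z}) 𝔮 ≠ ⊤ :=
    lengthAt_ne_top_of_isTorsion p _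
      (CccOneMuDictionaryEta.isTorsion_quotient_span_of_injective_of_ne_zero P.colPlus P.colPlus_injective
        (colPlus_z_ne_zero hp K₀ η V hgood hf ϖ hϖ κ γ W I P)) 𝔮 h𝔮
  have hA' : lengthAt (IwasawaAlgebra p) (I.H ⧸ Submodule.span (IwasawaAlgebra p) {P'.z}) 𝔮 ≠ ⊤ :=
    lengthAt_ne_top_of_isTorsion p _
      (CccOneMuDictionaryEta.isTorsion_quotient_span_of_injective_of_ne_zero P'.colPlus P'.colPlus_injective
        (colPlus_z_ne_zero hp K₀ η V hgood hf ϖ hϖ κ γ W I P')) 𝔮 h𝔮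
  rw [muInvariant_eq_toNat_lengthAt p _ 𝔮 h𝔮, muInvariant_eq_toNat_lengthAt p _ 𝔮 h𝔮] at hμ
  rw [← ENat.coe_toNat hA, ← ENat.coe_toNat hA', hμ]

/-! ## §2 Stub 2c's equality does not depend on the package -/

/-- **Stub 2c is PACKAGE-FREE.**  For every class `z₀ ≠ 0` of the pin (every admissible class is non-zero,
`CccOneCollinearMu.ne_zero_of_isAdmissibleZetaClass`) and any two packages `P` (over `FB`), `P′` (over `FB′`), at `𝔮 = (p)`:
`length_𝔮 (Λ ⧸ (P.colPlus z₀)) = length_𝔮 (Λ ⧸ (P.colPlus P.z))` IFF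
`length_𝔮 (Λ ⧸ (P′.colPlus z₀)) = length_𝔮 (Λ ⧸ (P′.colPlus P′.z))` — both sides are «ZC-μ»
`length_𝔮 (𝐇¹_Γ ⧸ Λ∙z₀) = length_𝔮 (𝐇¹_Γ ⧸ Λ∙P.z)` (Coleman-image form), whose right member is package-free (§1).
So the registered «for every package `P`» of stub 2c is no stronger than «for some package `P`».
[cite: Kobayashi2003, Thm. 6.3 (p. 11), Thm. 7.3 i) (p. 13)] [cite: Kato2004Asterisque, Conj. 12.10 (p. 224)]
[cite: BurungaleTian2026, Rem. 2.7 (p. 5)] -/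
theorem stub2c_iff_of_packages (hF : PublishedInputsEtaUpToP) {z₀ : I.H} (hz₀ : z₀ ≠ 0)
    (𝔮 : PrimeSpectrum (IwasawaAlgebra p)) (h𝔮 : 𝔮.asIdeal = augIdealP p) :
    (lengthAt (IwasawaAlgebra p) (IwasawaAlgebra p ⧸ Ideal.span {P.colPlus z₀}) 𝔮 =
        lengthAt (IwasawaAlgebra p) (IwasawaAlgebra p ⧸ Ideal.span {P.colPlus P.z}) 𝔮) ↔
      (lengthAt (IwasawaAlgebra p) (IwasawaAlgebra p ⧸ Ideal.span {P'.colPlus z₀}) 𝔮 =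
        lengthAt (IwasawaAlgebra p) (IwasawaAlgebra p ⧸ Ideal.span {P'.colPlus P'.z}) 𝔮) := by
  rw [← CccOneCollinearMu.lengthAt_quotient_span_eq_iff_lengthAt_image I hγ P.colPlus P.colPlus_injective hz₀ P.z
      𝔮 h𝔮,
    ← CccOneCollinearMu.lengthAt_quotient_span_eq_iff_lengthAt_image I hγ P'.colPlus P'.colPlus_injective hz₀ P'.z
      𝔮 h𝔮,
    lengthAt_quotient_kobayashiClass_eq_of_packages hp K₀ η hη hη1 V hCM hgood hap hf ϖ hϖ κ γ hκ hγ hγK hvar W I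
      P P' hF 𝔮 h𝔮]

omit [IsCyclotomicExtension {p} ℚ K₀] hη hη1 [V.IsGloballyMinimal] [NeZero N] hCM hgood hap hf hϖ hκ hγ hγK hvar in
/-- **Mixed form**: the stub-2c equality for `P` is also equivalent to the comparison of `P.colPlus z₀` against the
OTHER package's plus function `P′.colPlus P′.z` — all plus functions generate the same ideal
(`IsQuadraticBranchPlusLFunction.span_singleton_eq`), so the right member of stub 2c is literally «`μ(L_p⁺(V, η, X))`»,
whichever package or plus function names it. [cite: Kobayashi2003, Thm. 3.2 (p. 7), Thm. 6.3 (p. 11)] -/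
theorem lengthAt_colPlus_z_eq_of_packages (𝔮 : PrimeSpectrum (IwasawaAlgebra p)) :
    lengthAt (IwasawaAlgebra p) (IwasawaAlgebra p ⧸ Ideal.span {P.colPlus P.z}) 𝔮 =
      lengthAt (IwasawaAlgebra p) (IwasawaAlgebra p ⧸ Ideal.span {P'.colPlus P'.z}) 𝔮 := by
  have h := Kobayashi2003.IsQuadraticBranchPlusLFunction.span_singleton_eq hp P.isPlus_colPlus_z
    P'.isPlus_colPlus_z
  rw [Module.lengthAt_eq_of_linearEquiv (Submodule.quotEquivOfEq _ _ h) 𝔮]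

end Frame

/-! ## §3 One instance per pin: «∀ (FB, P, admissible z₀)» ⟺ «∃ (FB, P, admissible z₀)» -/

section Pin

variable (hp : p ≠ 2) (K₀ : Type) [Field K₀] [NumberField K₀]
  [IsCyclotomicExtension {p} ℚ K₀] [(galRange (K := ℚ) K₀).Normal]
  (η : absoluteGaloisGroup ℚ →* ℤˣ) (hη : ∀ σ ∈ galRange (K := ℚ) K₀, η σ = 1) (hη1 : η ≠ 1)
  (V : WeierstrassCurve ℚ) [V.IsElliptic] [V.IsGloballyMinimal] {N : ℕ} [NeZero N]
  {f : CuspForm (Gamma0 N) 2} (hCM : V.HasCM) (hgood : V.HasGoodReductionAtPrime p)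
  (hap : V.frobeniusTrace p = 0) (hf : IsNewformOf V f) (ϖ : ℚ)
  (hϖ : if Even (p / 2) then (ϖ : ℝ) * V.realPeriodRat = plusPeriod f
    else (ϖ : ℝ) * V.imaginaryPeriodRat = minusPeriod f)
  (κ : ZpExtension ℚ p) (γ : absoluteGaloisGroup ℚ) (hκ : κ.IsCyclotomic) (hγ : κ.IsTopGenerator γ)
  (hγK : γ ∈ galRange (K := ℚ) K₀) (hvar : IsCyclotomicVariable p γ)
  (W : WeierstrassCurve ℚ) [W.IsElliptic] [W.IsGloballyMinimal] [ContinuousSMul ℤ_[p] (W.tateModule p)]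
  (I : Kato2004.IwasawaH1Data W p κ γ)

include hp hη hη1 hCM hgood hap hf hϖ hγ hγK hvar

/-- **Stub 2c on a pin is ONE number.**  Granted 19867, the named fact ★
`Kato2004.exists_zetaClassPosition_of_rank_le_one` (Kato Thm. 12.5 (1) / §13.9 on the rank-`≤ 1` branch: all admissible
classes of a pin are `Λˣ`-multiples of each other) and `rank_Λ 𝐇¹_Γ(T_pW) ≤ 1` (a tree theorem on the rows from
Mordell–Weil rank one and `Ш[p^∞]` finite, `CccOneCollinearMu.rank_eq_one_of_isAdmissibleZetaClass`): on a fixed pin `I`,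
IF the stub-2c equality holds for ONE dual fine Selmer datum `FB`, ONE package `P` and ONE admissible class `z₀` at ONE
prime `𝔮 = (p)`, THEN it holds for EVERY `(FB′, P′, z₀′)` at every `𝔮′ = (p)` (the converse is trivial).  The
registered universal quantifiers of stub 2c over `(FB, P, z₀)` therefore carry exactly the content of one instance
per `(frame, pin)`. [cite: Kato2004Asterisque, Thm. 12.5 (1) (p. 221), §13.9 (p. 230 l. 4–9), Conj. 12.10 (p. 224)]
[cite: Kobayashi2003, Thm. 6.3 (p. 11), Thm. 7.3 i) (p. 13)] [cite: BurungaleTian2026, Rem. 2.7 (p. 5)] -/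
theorem stub2c_forall_of_exists (hF : PublishedInputsEtaUpToP) (hstar : exists_zetaClassPosition_of_rank_le_one)
    (hrank : Module.rank (IwasawaAlgebra p) I.H ≤ 1)
    (hex : ∃ (FB : W.FineSelmerDualData κ γ) (P : Kobayashi2003.EtaColemanPoitouTateData p K₀ η V f ϖ κ γ W I FB)
      (z₀ : I.H) (_ : IsAdmissibleZetaClass W p κ hκ I z₀) (𝔮 : PrimeSpectrum (IwasawaAlgebra p))
      (_ : 𝔮.asIdeal = augIdealP p),
        lengthAt (IwasawaAlgebra p) (IwasawaAlgebra p ⧸ Ideal.span {P.colPlus z₀}) 𝔮 =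
          lengthAt (IwasawaAlgebra p) (IwasawaAlgebra p ⧸ Ideal.span {P.colPlus P.z}) 𝔮)
    (FB' : W.FineSelmerDualData κ γ) (P' : Kobayashi2003.EtaColemanPoitouTateData p K₀ η V f ϖ κ γ W I FB')
    (z₀' : I.H) (hz₀' : IsAdmissibleZetaClass W p κ hκ I z₀') (𝔮' : PrimeSpectrum (IwasawaAlgebra p))
    (h𝔮' : 𝔮'.asIdeal = augIdealP p) :
    lengthAt (IwasawaAlgebra p) (IwasawaAlgebra p ⧸ Ideal.span {P'.colPlus z₀'}) 𝔮' =
      lengthAt (IwasawaAlgebra p) (IwasawaAlgebra p ⧸ Ideal.span {P'.colPlus P'.z}) 𝔮' := by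
  obtain ⟨FB, P, z₀, hz₀, 𝔮, h𝔮, h⟩ := hex
  -- the unique prime `(p)`
  have h𝔮𝔮 : 𝔮 = 𝔮' := PrimeSpectrum.ext (h𝔮.trans h𝔮'.symm)
  subst h𝔮𝔮
  -- read the instance as «ZC-μ» at `(z₀, P.z)`, move to `(z₀′, P′.z)`, and read back
  have hzc : lengthAt (IwasawaAlgebra p) (I.H ⧸ (IwasawaAlgebra p) ∙ z₀) 𝔮 =
      lengthAt (IwasawaAlgebra p) (I.H ⧸ (IwasawaAlgebra p) ∙ P.z) 𝔮 :=
    (CccOneCollinearMu.zcMu_iff_lengthAt_colPlus P hγ hz₀ 𝔮 h𝔮).mpr h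
  have hadm : lengthAt (IwasawaAlgebra p) (I.H ⧸ (IwasawaAlgebra p) ∙ z₀') 𝔮 =
      lengthAt (IwasawaAlgebra p) (I.H ⧸ (IwasawaAlgebra p) ∙ z₀) 𝔮 :=
    (CccOneCollinearMu.lengthAt_quotient_span_eq_of_admissible_pair I hstar hγ hp hrank hz₀ hz₀' 𝔮).symm
  have hpk := lengthAt_quotient_kobayashiClass_eq_of_packages hp K₀ η hη hη1 V hCM hgood hap hf ϖ hϖ κ γ hκ hγ hγK
    hvar W I P P' hF 𝔮 h𝔮
  exact (CccOneCollinearMu.zcMu_iff_lengthAt_colPlus P' hγ hz₀' 𝔮 h𝔮).mp (hadm.trans (hzc.trans hpk))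

/-! ## §4 The sufficient unit form «ZC» for one package gives stub 2c for every package -/

/-- **«ZC» at one package ⟹ stub 2c at every package (kernel, granted 19867).**  If an admissible class `z₀` is a
`Λˣ`-multiple of the class `P.z` of ONE Kobayashi package `P` — «ZC»: the `Ω_W`-normalised Kato zeta class of the
additive twist `W = V ⊗ η` IS, up to a unit of `Λ`, the `η`-component of the `Ω_V^±`-normalised Kato zeta class of
the good twin `V` (twist-compatibility of Kato's Euler system through the `ℚ(√p*)`-isomorphism `V ≅ W`; census of this
hand, NOT asserted) — then the stub-2c equality `length_(p) (Λ ⧸ (P′.colPlus z₀)) = length_(p) (Λ ⧸ (P′.colPlus P′.z))`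
holds for EVERY package `P′` on the pin. [cite: Kato2004Asterisque, Thm. 12.5 (1) (p. 221), Conj. 12.10 (p. 224)]
[cite: Kobayashi2003, Thm. 5.2 (p. 10), Thm. 6.3 (p. 11), Thm. 7.3 i) (p. 13)] [cite: BurungaleTian2026, Rem. 2.7 (p. 5)] -/
theorem stub2c_of_exists_units_smul (hF : PublishedInputsEtaUpToP) {FB : W.FineSelmerDualData κ γ}
    (P : Kobayashi2003.EtaColemanPoitouTateData p K₀ η V f ϖ κ γ W I FB) {z₀ : I.H}
    (hz₀ : IsAdmissibleZetaClass W p κ hκ I z₀)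
    (hZC : ∃ u : (IwasawaAlgebra p)ˣ, z₀ = (u : IwasawaAlgebra p) • P.z)
    {FB' : W.FineSelmerDualData κ γ} (P' : Kobayashi2003.EtaColemanPoitouTateData p K₀ η V f ϖ κ γ W I FB')
    (𝔮 : PrimeSpectrum (IwasawaAlgebra p)) (h𝔮 : 𝔮.asIdeal = augIdealP p) :
    lengthAt (IwasawaAlgebra p) (IwasawaAlgebra p ⧸ Ideal.span {P'.colPlus z₀}) 𝔮 =
      lengthAt (IwasawaAlgebra p) (IwasawaAlgebra p ⧸ Ideal.span {P'.colPlus P'.z}) 𝔮 := by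
  obtain ⟨u, hu⟩ := hZC
  have hzc : lengthAt (IwasawaAlgebra p) (I.H ⧸ (IwasawaAlgebra p) ∙ z₀) 𝔮 =
      lengthAt (IwasawaAlgebra p) (I.H ⧸ (IwasawaAlgebra p) ∙ P.z) 𝔮 :=
    CccOneCollinearMu.lengthAt_quotient_span_eq_of_eq_units_smul_H I hu 𝔮
  have hpk := lengthAt_quotient_kobayashiClass_eq_of_packages hp K₀ η hη hη1 V hCM hgood hap hf ϖ hϖ κ γ hκ hγ hγK
    hvar W I P P' hF 𝔮 h𝔮
  exact (CccOneCollinearMu.zcMu_iff_lengthAt_colPlus P' hγ hz₀ 𝔮 h𝔮).mp (hzc.trans hpk)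

/-- **The constant-unit form** (the shape the twist computation actually delivers: a CONSTANT `c ∈ ℤ_pˣ` with
`Col⁺(loc z₀) = c · Col⁺(loc P.z)`, i.e. `z₀ = c • P.z` by injectivity of `Col⁺`): then stub 2c holds for every package.
[cite: Kobayashi2003, Thm. 6.3 (p. 11), Thm. 7.3 i) (p. 13)] [cite: Kato2004Asterisque, Thm. 12.5 (1) (p. 221)] -/
theorem stub2c_of_colPlus_eq_C_units_mul (hF : PublishedInputsEtaUpToP) {FB : W.FineSelmerDualData κ γ}
    (P : Kobayashi2003.EtaColemanPoitouTateData p K₀ η V f ϖ κ γ W I FB) {z₀ : I.H}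
    (hz₀ : IsAdmissibleZetaClass W p κ hκ I z₀) (c : ℤ_[p]ˣ)
    (hc : P.colPlus z₀ = PowerSeries.C ((c : ℤ_[p])) * P.colPlus P.z)
    {FB' : W.FineSelmerDualData κ γ} (P' : Kobayashi2003.EtaColemanPoitouTateData p K₀ η V f ϖ κ γ W I FB')
    (𝔮 : PrimeSpectrum (IwasawaAlgebra p)) (h𝔮 : 𝔮.asIdeal = augIdealP p) :
    lengthAt (IwasawaAlgebra p) (IwasawaAlgebra p ⧸ Ideal.span {P'.colPlus z₀}) 𝔮 =
      lengthAt (IwasawaAlgebra p) (IwasawaAlgebra p ⧸ Ideal.span {P'.colPlus P'.z}) 𝔮 := by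
  refine stub2c_of_exists_units_smul hp K₀ η hη hη1 V hCM hgood hap hf ϖ hϖ κ γ hκ hγ hγK hvar W I hF P hz₀ ?_ P' 𝔮 h𝔮
  -- the constant unit of `ℤ_p` is a unit of `Λ`, and `Col⁺` is injective
  let u : (IwasawaAlgebra p)ˣ := Units.map (PowerSeries.C : ℤ_[p] →+* IwasawaAlgebra p).toMonoidHom c
  have hu : ((u : (IwasawaAlgebra p)ˣ) : IwasawaAlgebra p) = PowerSeries.C (c : ℤ_[p]) := rfl
  refine ⟨u, P.colPlus_injective ?_⟩
  rw [map_smul, smul_eq_mul, hc, hu]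

/-! ## §5 The typed residual in VALUE-LAW form: «Col⁺(loc z₀) is a plus function L_p⁺(V, η, X)» ⟹ stub 2c -/

omit hη hη1 hCM hgood hap hf hϖ hγ hγK hvar [IsCyclotomicExtension {p} ℚ K₀] [V.IsGloballyMinimal] [NeZero N]
  [W.IsGloballyMinimal] in
/-- **VALUE LAW ⟹ stub 2c at the same package (kernel, unconditional).**  If the plus-Coleman image
`P.colPlus z₀` of a class `z₀` (intended: an admissible Kato class of the twist `W = V ⊗ η`) has Kobayashi's
quadratic-branch PLUS interpolation property `IsQuadraticBranchPlusLFunction f p ϖ` — «`Col⁺(loc 𝐳_{γ_W}) = u·L_p⁺(V, η, X)`,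
`u ∈ ℤ_pˣ`: the signed `p`-adic `L`-function of the good twin at `η` IS the plus-Coleman image of Kato's `Ω_W`-normalised
zeta element of the additive twist» — then `(P.colPlus z₀) = (P.colPlus P.z)` as ideals (uniqueness of plus functions up
to `ℤ_pˣ`, `IsQuadraticBranchPlusLFunction.span_singleton_eq`), so the stub-2c equality holds at `P` at EVERY prime.
This value law is the natural print-shaped form of the residual of stub 2c: it follows on paper from Kato's Thm. 12.5 (1)
for `f_W` in the `ω_W`-coordinate (the admissible predicate's value law), Kobayashi's interpolation formula for `Col⁺` on
arbitrary local classes (proof of Thm. 6.3 via §8), and the transport `exp*_{ω_V} ∘ φ⁻¹ ∘ res = (p*)^{-1/2}·exp*_{ω_W}`,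
`Ω_W⁺ = |p*|^{-1/2}·Ω_V^{sgn p*}·(unit)` along the `ℚ(√p*)`-isomorphism `φ : V ≅ W` — the SAME factor on both sides, whence a
`p`-ADIC UNIT constant (census/derivation memo of this hand); it is NOT asserted here.
[cite: Kobayashi2003, Thm. 3.2 (p. 7), Thm. 5.2 i) (p. 9), Thm. 6.3 (p. 11), Thm. 7.3 i) (p. 13)]
[cite: Kato2004Asterisque, Thm. 12.5 (1) (p. 221)] -/
theorem stub2c_of_isPlus_colPlus {FB : W.FineSelmerDualData κ γ}
    (P : Kobayashi2003.EtaColemanPoitouTateData p K₀ η V f ϖ κ γ W I FB) {z₀ : I.H}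
    (hVL : Kobayashi2003.IsQuadraticBranchPlusLFunction f p ϖ (P.colPlus z₀))
    (𝔮 : PrimeSpectrum (IwasawaAlgebra p)) :
    lengthAt (IwasawaAlgebra p) (IwasawaAlgebra p ⧸ Ideal.span {P.colPlus z₀}) 𝔮 =
      lengthAt (IwasawaAlgebra p) (IwasawaAlgebra p ⧸ Ideal.span {P.colPlus P.z}) 𝔮 := by
  have h := Kobayashi2003.IsQuadraticBranchPlusLFunction.span_singleton_eq hp hVL P.isPlus_colPlus_z
  rw [Module.lengthAt_eq_of_linearEquiv (Submodule.quotEquivOfEq _ _ h) 𝔮]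

omit hη hη1 hCM hgood hap hf hϖ hγ hγK hvar [IsCyclotomicExtension {p} ℚ K₀] [V.IsGloballyMinimal] [NeZero N]
  [W.IsGloballyMinimal] in
/-- **VALUE LAW ⟹ «ZC» with a CONSTANT unit** (the converse packaging, unconditional): if `P.colPlus z₀` is a plus
function, then `z₀ = c • P.z` for a constant `c ∈ ℤ_pˣ` (two plus functions differ by a unit of `ℤ_p`,
`IsQuadraticBranchPlusLFunction.exists_units_smul_eq`; `Col⁺` is injective, Thm. 7.3 i)).  So the value law is
exactly «ZC» of hands -3 and -4 with the unit pinned to be constant. [cite: Kobayashi2003, Thm. 3.2 (p. 7), Thm. 6.3 (p. 11), Thm. 7.3 i) (p. 13)] -/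
theorem exists_eq_C_units_smul_of_isPlus_colPlus {FB : W.FineSelmerDualData κ γ}
    (P : Kobayashi2003.EtaColemanPoitouTateData p K₀ η V f ϖ κ γ W I FB) {z₀ : I.H}
    (hVL : Kobayashi2003.IsQuadraticBranchPlusLFunction f p ϖ (P.colPlus z₀)) :
    ∃ c : ℤ_[p]ˣ, z₀ = PowerSeries.C (c : ℤ_[p]) • P.z := by
  have hVLA : Additive.IsQuadraticBranchPlusLFunction f p ϖ (P.colPlus z₀) := hVL
  have hzA : Additive.IsQuadraticBranchPlusLFunction f p ϖ (P.colPlus P.z) := P.isPlus_colPlus_z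
  obtain ⟨c, hc⟩ := Additive.IsQuadraticBranchPlusLFunction.exists_units_smul_eq hp hzA hVLA
  refine ⟨c, P.colPlus_injective ?_⟩
  rw [map_smul, smul_eq_mul, hc, PowerSeries.smul_eq_C_mul]

/-- **VALUE LAW at one package ⟹ stub 2c at EVERY package** (granted 19867, for an admissible `z₀`): by §4 with the
constant unit of `exists_eq_C_units_smul_of_isPlus_colPlus`.  This is the form in which a typed value law would discharge
the registered stub 2c verbatim (all packages, all pins carrying the frame).
[cite: Kobayashi2003, Thm. 6.3 (p. 11), Thm. 7.3 i) (p. 13)] [cite: Kato2004Asterisque, Thm. 12.5 (1) (p. 221)]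
[cite: BurungaleTian2026, Rem. 2.7 (p. 5)] -/
theorem stub2c_of_isPlus_colPlus_of_packages (hF : PublishedInputsEtaUpToP) {FB : W.FineSelmerDualData κ γ}
    (P : Kobayashi2003.EtaColemanPoitouTateData p K₀ η V f ϖ κ γ W I FB) {z₀ : I.H}
    (hz₀ : IsAdmissibleZetaClass W p κ hκ I z₀)
    (hVL : Kobayashi2003.IsQuadraticBranchPlusLFunction f p ϖ (P.colPlus z₀))
    {FB' : W.FineSelmerDualData κ γ} (P' : Kobayashi2003.EtaColemanPoitouTateData p K₀ η V f ϖ κ γ W I FB')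
    (𝔮 : PrimeSpectrum (IwasawaAlgebra p)) (h𝔮 : 𝔮.asIdeal = augIdealP p) :
    lengthAt (IwasawaAlgebra p) (IwasawaAlgebra p ⧸ Ideal.span {P'.colPlus z₀}) 𝔮 =
      lengthAt (IwasawaAlgebra p) (IwasawaAlgebra p ⧸ Ideal.span {P'.colPlus P'.z}) 𝔮 := by
  obtain ⟨c, hc⟩ := exists_eq_C_units_smul_of_isPlus_colPlus hp K₀ η V ϖ κ γ W I P hVL
  refine stub2c_of_exists_units_smul hp K₀ η hη hη1 V hCM hgood hap hf ϖ hϖ κ γ hκ hγ hγK hvar W I hF P hz₀ ?_ P' 𝔮 h𝔮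
  let u : (IwasawaAlgebra p)ˣ := Units.map (PowerSeries.C : ℤ_[p] →+* IwasawaAlgebra p).toMonoidHom c
  have hu : ((u : (IwasawaAlgebra p)ˣ) : IwasawaAlgebra p) = PowerSeries.C (c : ℤ_[p]) := rfl
  exact ⟨u, by rw [hu, hc]⟩

end Pin

end Summit.BirchSwinnertonDyer.BirchSwinnertonDyer.Theorems.CccOnePackageRigidity

end
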